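import Summits.KontsevichZagierPeriods.KontsevichZagierPeriods.Theses.TerasomaMultiplication
import Summits.KontsevichZagierPeriods.KontsevichZagierPeriods.Theorems.MultiplicationThree.Negative.Pinned
import Summits.KontsevichZagierPeriods.KontsevichZagierPeriods.Theorems.MultiplicationThree.Negative.BolzaLever
import Literature.NumberTheory.Transcendental.KZMellinFibres
import Literature.NumberTheory.Transcendental.KZSubcalculusInvariants
import Literature.NumberTheory.Transcendental.KZDominatedFamilyRelations
import Literature.NumberTheory.Transcendental.KZLogCalculusProofs
import Literature.NumberTheory.Transcendental.KZSemialgebraicComplex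
import Mathlib.Analysis.SpecialFunctions.Pow.Deriv

/-!
# `MultiplicationThree` (stmt-KontsevichZagierPeriods-3598), line `bolza-involution-real-quotient`:
# stub S2, auxiliary file 1 — the cube-root chart as a bijection `lowerCell → Σ_neg`

Stub `stub_lowerCellToNegativeBranch` of the crux `MultiplicationThree` (route `TerasomaMultiplication`;
lead skeleton `Cruxes/MultiplicationThree/Lines/bolza-involution-real-quotient.lean`) pushes the lower
cell `{0 < u, 0 < v, v < 1 − u, u < (1−v)²}` of the sheared box (`u = x 0`, `v = x 1`) forward along
the cube-root chart of the idea card `bolza-involution-real-quotient`,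

  `Φ(u,v) = (u, a(u,v))`,  `a = −(z−1)²/z`,  `z = (v(1−v)/(1−u−v))^{1/3}`,

onto the negative branch `Σ_neg = {0 < u < 1, a < 0}` of the level cubics `w² = a²(3−a)² − 4ua`.
This file proves the SET-THEORETIC half of that rule-(2) move, by pure algebra:

* on the lower cell `0 < z < 1` (the tree's `bolza_chart_lt_one_iff`), hence `a < 0`, and `u < 1`:
  `Φ` maps the lower cell into `Σ_neg` (`s2_mapsTo_chart`);
* `Φ` is injective on the lower cell (`s2_injOn_chart`): `z ↦ −(z−1)²/z = 2 − z − 1/z` is injective on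
  `(0,1)` (`(z₁−z₂)(z₁z₂−1) = 0`), and `v ↦ v(1−v)/(1−u−v)` is injective on `(0,1−u)`
  (`v₁(1−v₁)(1−u−v₂) − v₂(1−v₂)(1−u−v₁) = (v₁−v₂)((1−u−v₁)(1−u−v₂) + u(1−u))`);
* `Φ` maps onto `Σ_neg` (`s2_image_chart`) with the EXPLICIT inverse: given `0 < u < 1`, `a < 0`, put
  `z = ((2−a) − √(a²−4a))/2 ∈ (0,1)` (the root of `z² − (2−a)z + 1 = 0`, so `−(z−1)²/z = a`),
  `Z = z³`, `v = ((1+Z) − √((1+Z)² − 4Z(1−u)))/2 ∈ (0, 1−u)` (the root of `v² − (1+Z)v + Z(1−u) = 0`,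
  so `v(1−v)/(1−u−v) = Z`); then `(u,v)` lies in the lower cell and `Φ(u,v) = (u,a)`.

Nothing is defined in this file: the cells and the chart are written out.

References: M. Kontsevich, D. Zagier, *Periods* (2001), §1.2 rule (2).
-/

noncomputable section

open Set
open Literature.NumberTheory.Transcendental Literature.NumberTheory.Transcendental.KZ

namespace Summit.KontsevichZagierPeriods.TerasomaMultiplication.MultiplicationThreeBolza

open Summit.KontsevichZagierPeriods.TerasomaMultiplication.MultiplicationThreeNegative

/-! ### Small algebra -/

/-- The level `g = v(1−v)/(1−u−v)` is recovered from its cube root: if the cube roots of two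
non-negative levels agree, the levels agree. [folklore] -/
theorem s2_eq_of_cbrt_eq {g g' : ℝ} (hg : 0 ≤ g) (hg' : 0 ≤ g')
    (h : g ^ ((1:ℝ)/3) = g' ^ ((1:ℝ)/3)) : g = g' := by
  have e : ∀ {t : ℝ}, 0 ≤ t → (t ^ ((1:ℝ)/3)) ^ 3 = t := fun ht => by
    rw [← Real.rpow_natCast, ← Real.rpow_mul ht]; norm_num
  rw [← e hg, ← e hg', h]

/-- The cube root of a cube: `(z³)^{1/3} = z` for `z ≥ 0`. [folklore] -/
theorem s2_cbrt_of_pow_three {z : ℝ} (hz : 0 ≤ z) : (z ^ 3) ^ ((1:ℝ)/3) = z := by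
  rw [show z ^ 3 = z ^ (3:ℝ) by norm_cast, ← Real.rpow_mul hz]; norm_num

/-- `z ↦ −(z−1)²/z` is injective on `(0,1)`: `(z₁ − z₂)(z₁z₂ − 1) = 0`. [folklore] -/
theorem s2_neg_sq_div_injOn {z₁ z₂ : ℝ} (h₁ : 0 < z₁) (h₁' : z₁ < 1) (h₂ : 0 < z₂) (h₂' : z₂ < 1)
    (h : -(z₁ - 1) ^ 2 / z₁ = -(z₂ - 1) ^ 2 / z₂) : z₁ = z₂ := by
  rw [div_eq_div_iff h₁.ne' h₂.ne'] at h
  have hfac : (z₁ - z₂) * (z₁ * z₂ - 1) = 0 := by linear_combination -h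
  rcases mul_eq_zero.mp hfac with h0 | h0
  · linarith
  · nlinarith [mul_lt_mul'' h₁' h₂' h₁.le h₂.le]

/-- `v ↦ v(1−v)/(1−u−v)` is injective on `(0, 1−u)` for `0 < u < 1`: after cross-multiplying,
`(v₁ − v₂)((1−u−v₁)(1−u−v₂) + u(1−u)) = 0`. [folklore] -/
theorem s2_level_injOn {u v₁ v₂ : ℝ} (hu : 0 < u) (hu1 : u < 1) (hv₁ : v₁ < 1 - u) (hv₂ : v₂ < 1 - u)
    (h : v₁ * (1 - v₁) / (1 - u - v₁) = v₂ * (1 - v₂) / (1 - u - v₂)) : v₁ = v₂ := by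
  have hN₁ : 0 < 1 - u - v₁ := by linarith
  have hN₂ : 0 < 1 - u - v₂ := by linarith
  rw [div_eq_div_iff hN₁.ne' hN₂.ne'] at h
  have hfac : (v₁ - v₂) * ((1 - u - v₁) * (1 - u - v₂) + u * (1 - u)) = 0 := by
    linear_combination h
  rcases mul_eq_zero.mp hfac with h0 | h0
  · linarith
  · nlinarith [mul_pos hN₁ hN₂, mul_pos hu (sub_pos.2 hu1)]

/-! ### The chart maps the lower cell into `Σ_neg`, injectively -/

/-- Basic bounds on the lower cell: `0 < u < 1`, `0 < v < 1 − u`, `0 < 1 − u − v`, the level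
`g = v(1−v)/(1−u−v)` is positive and its cube root `z` lies in `(0,1)`. [folklore] -/
theorem s2_lowerCell_bounds {x : Fin 2 → ℝ}
    (hx : x ∈ {x : Fin 2 → ℝ | 0 < x 0 ∧ 0 < x 1 ∧ x 1 < 1 - x 0 ∧ x 0 < (1 - x 1) ^ 2}) :
    0 < x 0 ∧ x 0 < 1 ∧ 0 < x 1 ∧ x 1 < 1 - x 0 ∧ 0 < 1 - x 0 - x 1 ∧
      0 < x 1 * (1 - x 1) / (1 - x 0 - x 1) ∧
      0 < (x 1 * (1 - x 1) / (1 - x 0 - x 1)) ^ ((1:ℝ)/3) ∧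
      (x 1 * (1 - x 1) / (1 - x 0 - x 1)) ^ ((1:ℝ)/3) < 1 := by
  obtain ⟨h0, h1, h2, h3⟩ := hx
  have hN : 0 < 1 - x 0 - x 1 := by linarith
  have h1v : 0 < 1 - x 1 := by linarith
  have hg : 0 < x 1 * (1 - x 1) / (1 - x 0 - x 1) := div_pos (mul_pos h1 h1v) hN
  have hu1 : x 0 < 1 := by nlinarith
  exact ⟨h0, hu1, h1, h2, hN, hg, Real.rpow_pos_of_pos hg _,
    (bolza_chart_lt_one_iff h0 h1 h2).mpr h3⟩

/-- On the lower cell the chart value `a = −(z−1)²/z` is negative. [folklore] -/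
theorem s2_chart_neg {x : Fin 2 → ℝ}
    (hx : x ∈ {x : Fin 2 → ℝ | 0 < x 0 ∧ 0 < x 1 ∧ x 1 < 1 - x 0 ∧ x 0 < (1 - x 1) ^ 2}) :
    -((x 1 * (1 - x 1) / (1 - x 0 - x 1)) ^ ((1:ℝ)/3) - 1) ^ 2 /
        (x 1 * (1 - x 1) / (1 - x 0 - x 1)) ^ ((1:ℝ)/3) < 0 := by
  obtain ⟨-, -, -, -, -, -, hz, hz1⟩ := s2_lowerCell_bounds hx
  apply div_neg_of_neg_of_pos _ hz
  have : (x 1 * (1 - x 1) / (1 - x 0 - x 1)) ^ ((1:ℝ)/3) - 1 ≠ 0 := by linarith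
  have : 0 < ((x 1 * (1 - x 1) / (1 - x 0 - x 1)) ^ ((1:ℝ)/3) - 1) ^ 2 := by positivity
  linarith

/-- The chart maps the lower cell into the negative branch `{0 < u < 1, a < 0}`. [folklore] -/
theorem s2_mapsTo_chart :
    MapsTo (fun y : Fin 2 → ℝ => (![y 0, -((y 1 * (1 - y 1) / (1 - y 0 - y 1)) ^ ((1:ℝ)/3) - 1) ^ 2 /
        (y 1 * (1 - y 1) / (1 - y 0 - y 1)) ^ ((1:ℝ)/3)] : Fin 2 → ℝ))
      {x : Fin 2 → ℝ | 0 < x 0 ∧ 0 < x 1 ∧ x 1 < 1 - x 0 ∧ x 0 < (1 - x 1) ^ 2}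
      {x : Fin 2 → ℝ | 0 < x 0 ∧ x 0 < 1 ∧ x 1 < 0} := by
  intro x hx
  obtain ⟨h0, hu1, -⟩ := s2_lowerCell_bounds hx
  exact ⟨h0, hu1, s2_chart_neg hx⟩

/-- The chart is injective on the lower cell. [folklore] -/
theorem s2_injOn_chart :
    InjOn (fun y : Fin 2 → ℝ => (![y 0, -((y 1 * (1 - y 1) / (1 - y 0 - y 1)) ^ ((1:ℝ)/3) - 1) ^ 2 /
        (y 1 * (1 - y 1) / (1 - y 0 - y 1)) ^ ((1:ℝ)/3)] : Fin 2 → ℝ))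
      {x : Fin 2 → ℝ | 0 < x 0 ∧ 0 < x 1 ∧ x 1 < 1 - x 0 ∧ x 0 < (1 - x 1) ^ 2} := by
  intro x hx y hy hxy
  obtain ⟨hx0, hxu1, -, hx2, -, hgx, hzx, hzx1⟩ := s2_lowerCell_bounds hx
  obtain ⟨-, -, -, hy2, -, hgy, hzy, hzy1⟩ := s2_lowerCell_bounds hy
  have h0 : x 0 = y 0 := by
    have := congrFun hxy 0
    simpa only [Matrix.cons_val_zero] using this
  have h1 : -((x 1 * (1 - x 1) / (1 - x 0 - x 1)) ^ ((1:ℝ)/3) - 1) ^ 2 /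
        (x 1 * (1 - x 1) / (1 - x 0 - x 1)) ^ ((1:ℝ)/3) =
      -((y 1 * (1 - y 1) / (1 - y 0 - y 1)) ^ ((1:ℝ)/3) - 1) ^ 2 /
        (y 1 * (1 - y 1) / (1 - y 0 - y 1)) ^ ((1:ℝ)/3) := by
    have := congrFun hxy 1
    simpa only [Matrix.cons_val_one, Matrix.head_cons, Matrix.cons_val_zero] using this
  have hz : (x 1 * (1 - x 1) / (1 - x 0 - x 1)) ^ ((1:ℝ)/3) =
      (y 1 * (1 - y 1) / (1 - y 0 - y 1)) ^ ((1:ℝ)/3) :=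
    s2_neg_sq_div_injOn hzx hzx1 hzy hzy1 h1
  have hg : x 1 * (1 - x 1) / (1 - x 0 - x 1) = y 1 * (1 - y 1) / (1 - y 0 - y 1) :=
    s2_eq_of_cbrt_eq hgx.le hgy.le hz
  rw [← h0] at hg hy2
  have hv : x 1 = y 1 := s2_level_injOn hx0 hxu1 hx2 hy2 hg
  funext i
  fin_cases i
  · exact h0
  · exact hv

/-! ### The explicit inverse: the chart maps the lower cell ONTO `Σ_neg` -/

/-- The `z`-root: for `a < 0`, `z = ((2−a) − √(a²−4a))/2` lies in `(0,1)` and satisfies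
`−(z−1)²/z = a`. [folklore] -/
theorem s2_zroot {a : ℝ} (ha : a < 0) :
    0 < ((2 - a) - Real.sqrt (a ^ 2 - 4 * a)) / 2 ∧ ((2 - a) - Real.sqrt (a ^ 2 - 4 * a)) / 2 < 1 ∧
      -(((2 - a) - Real.sqrt (a ^ 2 - 4 * a)) / 2 - 1) ^ 2 / (((2 - a) - Real.sqrt (a ^ 2 - 4 * a)) / 2) =
        a := by
  set S := Real.sqrt (a ^ 2 - 4 * a) with hS
  have hd : 0 < a ^ 2 - 4 * a := by nlinarith
  have hS0 : 0 ≤ S := Real.sqrt_nonneg _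
  have hS2 : S ^ 2 = a ^ 2 - 4 * a := Real.sq_sqrt hd.le
  have hSlt : S < 2 - a := by nlinarith
  have hSgt : -a < S := by nlinarith
  have hz0 : 0 < ((2 - a) - S) / 2 := by linarith
  refine ⟨hz0, by linarith, ?_⟩
  rw [div_eq_iff hz0.ne']
  linear_combination (-1/4:ℝ) * hS2

/-- The `v`-root: for `0 < u < 1` and `0 < Z`, `v = ((1+Z) − √((1+Z)² − 4Z(1−u)))/2` lies in
`(0, 1−u)` and has level `v(1−v)/(1−u−v) = Z`. [folklore] -/
theorem s2_vroot {u Z : ℝ} (hu : 0 < u) (hu1 : u < 1) (hZ : 0 < Z) :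
    0 < ((1 + Z) - Real.sqrt ((1 + Z) ^ 2 - 4 * Z * (1 - u))) / 2 ∧
      ((1 + Z) - Real.sqrt ((1 + Z) ^ 2 - 4 * Z * (1 - u))) / 2 < 1 - u ∧
      ((1 + Z) - Real.sqrt ((1 + Z) ^ 2 - 4 * Z * (1 - u))) / 2 *
            (1 - ((1 + Z) - Real.sqrt ((1 + Z) ^ 2 - 4 * Z * (1 - u))) / 2) /
          (1 - u - ((1 + Z) - Real.sqrt ((1 + Z) ^ 2 - 4 * Z * (1 - u))) / 2) = Z := by
  set T := Real.sqrt ((1 + Z) ^ 2 - 4 * Z * (1 - u)) with hT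
  have hd : 0 < (1 + Z) ^ 2 - 4 * Z * (1 - u) := by nlinarith [sq_nonneg (1 - Z), mul_pos hu hZ]
  have hT0 : 0 ≤ T := Real.sqrt_nonneg _
  have hT2 : T ^ 2 = (1 + Z) ^ 2 - 4 * Z * (1 - u) := Real.sq_sqrt hd.le
  have hTlt : T < 1 + Z := by nlinarith
  have hTgt : 2 * u - 1 + Z < T := by
    by_contra hcon
    rw [not_lt] at hcon
    have h1 : 0 ≤ 2 * u - 1 + Z := le_trans hT0 hcon
    nlinarith [mul_nonneg (sub_nonneg.2 hcon) (add_nonneg h1 hT0), mul_pos hu (sub_pos.2 hu1)]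
  have hv0 : 0 < ((1 + Z) - T) / 2 := by linarith
  have hv1 : ((1 + Z) - T) / 2 < 1 - u := by linarith
  refine ⟨hv0, hv1, ?_⟩
  have hN : 0 < 1 - u - ((1 + Z) - T) / 2 := by linarith
  rw [div_eq_iff hN.ne']
  linear_combination (-1/4:ℝ) * hT2

/-- The chart maps the lower cell ONTO the negative branch. [folklore] -/
theorem s2_image_chart :
    (fun y : Fin 2 → ℝ => (![y 0, -((y 1 * (1 - y 1) / (1 - y 0 - y 1)) ^ ((1:ℝ)/3) - 1) ^ 2 /
        (y 1 * (1 - y 1) / (1 - y 0 - y 1)) ^ ((1:ℝ)/3)] : Fin 2 → ℝ)) ''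
        {x : Fin 2 → ℝ | 0 < x 0 ∧ 0 < x 1 ∧ x 1 < 1 - x 0 ∧ x 0 < (1 - x 1) ^ 2} =
      {x : Fin 2 → ℝ | 0 < x 0 ∧ x 0 < 1 ∧ x 1 < 0} := by
  refine (s2_mapsTo_chart.image_subset).antisymm fun y hy => ?_
  obtain ⟨hu, hu1, ha⟩ := hy
  obtain ⟨hz0, hz1, hza⟩ := s2_zroot ha
  set z := ((2 - y 1) - Real.sqrt (y 1 ^ 2 - 4 * y 1)) / 2 with hzdef
  obtain ⟨hv0, hv1, hvZ⟩ := s2_vroot hu hu1 (pow_pos hz0 3)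
  set v := ((1 + z ^ 3) - Real.sqrt ((1 + z ^ 3) ^ 2 - 4 * z ^ 3 * (1 - y 0))) / 2 with hvdef
  have hcb : (v * (1 - v) / (1 - y 0 - v)) ^ ((1:ℝ)/3) = z := by
    rw [hvZ, s2_cbrt_of_pow_three hz0.le]
  have hmem : (![y 0, v] : Fin 2 → ℝ) ∈
      {x : Fin 2 → ℝ | 0 < x 0 ∧ 0 < x 1 ∧ x 1 < 1 - x 0 ∧ x 0 < (1 - x 1) ^ 2} := by
    refine ⟨hu, hv0, hv1, ?_⟩
    show y 0 < (1 - v) ^ 2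
    exact (bolza_chart_lt_one_iff hu hv0 hv1).mp (by rw [hcb]; exact hz1)
  refine ⟨![y 0, v], hmem, ?_⟩
  show (![y 0, -((v * (1 - v) / (1 - y 0 - v)) ^ ((1:ℝ)/3) - 1) ^ 2 /
      (v * (1 - v) / (1 - y 0 - v)) ^ ((1:ℝ)/3)] : Fin 2 → ℝ) = y
  rw [hcb, hza]
  funext i
  fin_cases i <;> rfl

end Summit.KontsevichZagierPeriods.TerasomaMultiplication.MultiplicationThreeBolza

end
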